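import Literature.AlgebraicGeometry.HodgeTheory.QuaternionicQuarticDeckChartGeneric
import Literature.AlgebraicGeometry.Resolution.EquivariantProjectiveCompletion
import Literature.AlgebraicGeometry.Resolution.FunctorialResolutionAutomorphisms
import Literature.AlgebraicGeometry.Resolution.SmoothGeometricallyIrreducibleResolution
import Literature.AlgebraicGeometry.Resolution.BirationalDimensionInequality
import Literature.AlgebraicGeometry.Resolution.AlterationsDimension
import Literature.AlgebraicGeometry.Motives.AbelianVarietyProofs
import Literature.AlgebraicGeometry.Motives.VarietiesDimensionProofs
import HarnessLib

/-!
# The generic smooth projective `Q₈`-model of the quaternionic quartic family (programme «M1», brick M1-4a)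

Layer `Literature/AlgebraicGeometry/HodgeTheory`. Theorems (no new named fact; CONDITIONAL on the named fact
`Resolution.Kollar2007_resolutionLiftsAutomorphisms`, Kollár 2007 Thm. 3.36 + §3.4.1, taken as a hypothesis). Written
by the prover seat `hodge-nonav-prover-Bx` (g19, cell `hodge-nonav`), programme M1 (memo `PROGRAMME-M1-Bx-g19.md`) for
route `HodgeConjecture/Q8SymplecticPowers` (crux K1Q, stmt-HodgeConjecture-24190).

**`exists_genericModel`.** Let `A = ℂ[a]`, `K = Frac A`, `e ≥ 2`, and let `U = genericChart e K` be the generic étale chart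
with its `Q₈`-action (`QuaternionicQuarticDeckChartGeneric`: affine, integral, regular, of finite type, smooth of relative
dimension `2`, geometrically irreducible). GIVEN Kollár's lifting fact, there is a smooth projective geometrically irreducible
`K`-surface `E` (`IsSmoothProjective 2 E`) with an action `ρE` of `Q₈` over `K` and a `Q₈`-EQUIVARIANT open immersion
`θ : U ↪ E` over `K`. Construction: the equivariant projective completion `U ↪ N` (brick M1-2,
`Resolution.exists_equivariant_projective_completion`); `N` is geometrically irreducible (dense open `U`); the functorial
resolution `r : Y → N` with the lifted action (brick M1-3, `Kollar2007_resolutionLiftsAutomorphisms.exists_actionOver`), smooth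
(regular over a field of characteristic `0`, `Resolution.smooth_of_isRegular_of_perfectField`), geometrically irreducible
(`Resolution.geometricallyIrreducible_of_isResolution`), of dimension `dim Y = dim N = dim U = 2`; since `U` is regular, `r` is an
isomorphism over the image of `U`, which lifts `U ↪ N` to `θ : U ↪ Y`, equivariantly (two morphisms into `Y` over the same
morphism into `N` that land in `r⁻¹(U)` coincide).

Honest scope: conditional on ONE published theorem (Kollár); nothing here bears on HC.

## References

* [Kollar2007] J. Kollár, Lectures on Resolution of Singularities (2007), Thm. 3.36, §3.4.1.
* [DeJong1996] A. J. de Jong, Smoothness, semi-stability and alterations (1996), 4.17.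
* [StacksProject] The Stacks Project, Tags 038F, 0AVK.
-/

noncomputable section

open CategoryTheory CategoryTheory.Limits AlgebraicGeometry TopologicalSpace

namespace Literature.AlgebraicGeometry.HodgeTheory.Q8Family

open Literature.AlgebraicGeometry.Motives Literature.AlgebraicGeometry.RelativeSpec
  Literature.AlgebraicGeometry.Resolution

/-- Two morphisms into the source of `r` which agree after `r` and both land in an open `r⁻¹(V)` over which `r` is an
isomorphism coincide. [cite: Kollar2007, §3.4.1 (p. 121)] -/
theorem eq_of_comp_eq_of_range_subset {Z Y N : Scheme} (r : Y ⟶ N) (V : N.Opens) [IsIso (r ∣_ V)] {a b : Z ⟶ Y}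
    (hab : a ≫ r = b ≫ r) (ha : ∀ z, r (a z) ∈ V) (hb : ∀ z, r (b z) ∈ V) : a = b := by
  have hra : Set.range a ⊆ Set.range (r ⁻¹ᵁ V).ι := by
    rintro _ ⟨z, rfl⟩; rw [Scheme.Opens.range_ι]; exact ha z
  have hrb : Set.range b ⊆ Set.range (r ⁻¹ᵁ V).ι := by
    rintro _ ⟨z, rfl⟩; rw [Scheme.Opens.range_ι]; exact hb z
  let a' := IsOpenImmersion.lift (r ⁻¹ᵁ V).ι a hra
  let b' := IsOpenImmersion.lift (r ⁻¹ᵁ V).ι b hrb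
  have ha' : a' ≫ (r ⁻¹ᵁ V).ι = a := IsOpenImmersion.lift_fac _ _ _
  have hb' : b' ≫ (r ⁻¹ᵁ V).ι = b := IsOpenImmersion.lift_fac _ _ _
  have h1 : a' ≫ (r ∣_ V) = b' ≫ (r ∣_ V) := by
    rw [← cancel_mono V.ι, Category.assoc, Category.assoc, morphismRestrict_ι, ← Category.assoc, ← Category.assoc,
      ha', hb', hab]
  rw [← ha', ← hb', (cancel_mono (r ∣_ V)).mp h1]

variable (e : ℕ)

/-- **The generic smooth projective `Q₈`-model.** GIVEN Kollár's lifting fact: a smooth projective geometrically irreducible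
`K`-surface `E` (`K = Frac ℂ[a]`) with a `Q₈`-action and a `Q₈`-equivariant open immersion of the generic étale chart
`genericChart e K ↪ E` over `K` (`e ≥ 2`). [cite: Kollar2007, Thm. 3.36 and §3.4.1 (p. 121)] [cite: DeJong1996, 4.17, p. 72] -/
theorem exists_genericModel (h : Kollar2007_resolutionLiftsAutomorphisms.{0}) (he : 2 ≤ e) :
    ∃ (E : SchemeOver (FractionRing (ParamRing e))) (ρE : ActionOver E.hom (QuaternionGroup 2))
      (θ : genericChart e (FractionRing (ParamRing e)) ⟶ E),
      IsSmoothProjective 2 E ∧ IsOpenImmersion θ.left ∧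
      ∀ g : QuaternionGroup 2,
        ((genericAction e (FractionRing (ParamRing e))).aut g).hom ≫ θ.left = θ.left ≫ (ρE.aut g).hom := by
  set K : Type := FractionRing (ParamRing e) with hK
  haveI : CharZero K := charZero_of_injective_algebraMap (IsFractionRing.injective (ParamRing e) K)
  let U : SchemeOver K := genericChart e K
  let ρU : ActionOver U.hom (QuaternionGroup 2) := genericAction e K
  haveI : IsAffine U.left := isAffine_genericChart e K
  haveI : IsIntegral U.left := isIntegral_genericChart e K he
  haveI : LocallyOfFiniteType U.hom := locallyOfFiniteType_genericChart e K
  haveI : SmoothOfRelativeDimension 2 U.hom := smoothOfRelativeDimension_genericChart e K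
  haveI : GeometricallyIrreducible U.hom := geometricallyIrreducible_genericChart e K he
  have hUreg : Scheme.IsRegular U.left := isRegular_genericChart e K
  -- ### (1) equivariant projective completion `ι : U ↪ N`
  obtain ⟨N, ρN, ι, hNint, hNproj, hιopen, hιeq⟩ := exists_equivariant_projective_completion U ρU
  haveI := hNint
  haveI := hιopen
  haveI : IsProper N.hom := IsProjectiveOver.isProper hNproj
  haveI : IsLocallyNoetherian N.left := LocallyOfFiniteType.isLocallyNoetherian N.hom
  let V : N.left.Opens := ι.left.opensRange
  -- `N` is geometrically irreducible: `U ≅ V` is a dense open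
  have hUV : U.hom = (ι.left.isoOpensRange.hom ≫ V.ι) ≫ N.hom := by
    rw [Scheme.Hom.isoOpensRange_hom_ι, Over.w ι]
  haveI : GeometricallyIrreducible (V.ι ≫ N.hom) := by
    have hgi : GeometricallyIrreducible ((ι.left.isoOpensRange.hom ≫ V.ι) ≫ N.hom) := by rw [← hUV]; infer_instance
    rw [Category.assoc] at hgi
    exact (MorphismProperty.cancel_left_of_respectsIso @GeometricallyIrreducible _ _).mp hgi
  have hVdense : Dense (V : Set N.left) := by
    obtain ⟨u⟩ := (inferInstance : Nonempty U.left)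
    exact V.2.dense ⟨ι.left u, ⟨u, rfl⟩⟩
  haveI : GeometricallyIrreducible N.hom := geometricallyIrreducible_of_dense_opens N.hom V hVdense
  -- ### (2) the functorial resolution with the lifted action
  obtain ⟨Y, r, ρY, hr, hYproj, hreg, hYeq⟩ := h.exists_actionOver N hNproj ρN
  let E : SchemeOver K := Over.mk (r ≫ N.hom)
  haveI : IsProper E.hom := IsProjectiveOver.isProper hYproj
  haveI : IsProper (r ≫ N.hom) := inferInstanceAs (IsProper E.hom)
  haveI : Smooth (r ≫ N.hom) := smooth_of_isRegular_of_perfectField _ hr.isRegular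
  have hgiY : GeometricallyIrreducible (r ≫ N.hom) := geometricallyIrreducible_of_isResolution N.hom hr
  haveI : IrreducibleSpace Y := hr.isBirational.irreducibleSpace
  obtain ⟨d, hd⟩ := exists_smoothOfRelativeDimension_of_smooth (r ≫ N.hom)
  haveI := hd
  -- `dim Y = dim N = dim U = 2`
  have hdimU : topologicalKrullDim U.left = (2 : ℕ) := topologicalKrullDim_eq_of_smoothOfRelativeDimension U.hom 2
  have hdimUN : topologicalKrullDim U.left = topologicalKrullDim N.left :=
    topologicalKrullDim_eq_of_isOpenImmersion N.hom ι.left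
  have hdimYN : topologicalKrullDim Y = topologicalKrullDim N.left := hr.topologicalKrullDim_eq
  have hdimY : topologicalKrullDim Y = (d : ℕ) := topologicalKrullDim_eq_of_smoothOfRelativeDimension (r ≫ N.hom) d
  have hd2 : d = 2 := by
    have h1 : ((d : ℕ∞) : WithBot ℕ∞) = ((2 : ℕ) : ℕ∞) := by
      exact hdimY.symm.trans (hdimYN.trans (hdimUN.symm.trans hdimU))
    exact_mod_cast h1
  subst hd2
  have hE : IsSmoothProjective 2 E := ⟨hd, hYproj, hgiY⟩
  -- ### (3) the lift `θ : U ↪ Y` of `ι` (the image of `U` lies in the regular locus, over which `r` is an isomorphism)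
  have hVreg : ∀ x ∈ V, IsRegularLocalRing (N.left.presheaf.stalk x) := by
    rintro _ ⟨u, rfl⟩
    haveI := hUreg u
    exact IsRegularLocalRing.of_ringEquiv (asIso (ι.left.stalkMap u)).commRingCatIsoToRingEquiv.symm
  haveI : IsIso (r ∣_ V) := hreg V hVreg
  let θl : U.left ⟶ Y := ι.left.isoOpensRange.hom ≫ inv (r ∣_ V) ≫ (r ⁻¹ᵁ V).ι
  have hθr : θl ≫ r = ι.left := by
    change (ι.left.isoOpensRange.hom ≫ inv (r ∣_ V) ≫ (r ⁻¹ᵁ V).ι) ≫ r = ι.left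
    rw [Category.assoc, Category.assoc, ← morphismRestrict_ι, IsIso.inv_hom_id_assoc, Scheme.Hom.isoOpensRange_hom_ι]
  have hθw : θl ≫ E.hom = U.hom := by
    change θl ≫ r ≫ N.hom = U.hom
    rw [← Category.assoc, hθr, Over.w ι]
  let θ : U ⟶ E := Over.homMk θl hθw
  haveI : IsOpenImmersion θl := inferInstance
  refine ⟨E, ρY, θ, hE, inferInstanceAs (IsOpenImmersion θl), fun g => ?_⟩
  -- ### (4) equivariance
  change (ρU.aut g).hom ≫ θl = θl ≫ (ρY.aut g).hom
  have hc : ((ρU.aut g).hom ≫ θl) ≫ r = ι.left ≫ (ρN.aut g).hom := by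
    rw [Category.assoc, hθr]; exact hιeq g
  have hc' : (θl ≫ (ρY.aut g).hom) ≫ r = ι.left ≫ (ρN.aut g).hom := by
    rw [Category.assoc, hYeq g, ← Category.assoc, hθr]
  have hrange : ∀ u : U.left, (ι.left ≫ (ρN.aut g).hom) u ∈ V := fun u => by
    rw [← hιeq g, Scheme.Hom.comp_apply]
    exact ⟨_, rfl⟩
  refine eq_of_comp_eq_of_range_subset r V (hc.trans hc'.symm) (fun u => ?_) (fun u => ?_)
  · rw [← Scheme.Hom.comp_apply, hc]; exact hrange u
  · rw [← Scheme.Hom.comp_apply, hc']; exact hrange u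

end Literature.AlgebraicGeometry.HodgeTheory.Q8Family

end
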